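import Mathlib

/-!
# Crux `FeketeSOS.SublinearShadow` (stmt-ValiantsHypothesis-14990), line `Sketch`,
# stub `stub_trivialShadow`: the universal two-square shadow in odd characteristic

In the composition this stub dispatches the "many squares" regime.  Over a field of odd
characteristic every polynomial `f` is a weighted sum of two squares of polynomials of the same
degree, `f = ((f + 1)/2)² − ((f − 1)/2)²`.  Applied to the reduced Fekete polynomial
`F̄_p := ∑_{m ∈ range p} C ((legendreSym p m : ℤ) : ZMod p) · X^m ∈ (ZMod p)[X]` this gives the
shadow with `d = 2` squares `g'₀ = C 2⁻¹ · (F̄_p + 1)`, `g'₁ = C 2⁻¹ · (F̄_p − 1)`, weights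
`c' = (1, −1)`, both of `natDegree < p` (as `F̄_p` has), hence of support `≤ p` each, `≤ 2p` total.

Proof: `(2 : ZMod p) ≠ 0` for `p ≠ 2` (`Ring.two_ne_zero`, `ZMod.ringChar_zmod_n`), so
`C 2⁻¹ * 2 = 1` in `(ZMod p)[X]` and the identity is a `linear_combination` of this relation;
degrees by `Polynomial.natDegree_sum_le_of_forall_le` / `natDegree_C_mul_X_pow_le`; supports by
`Polynomial.supp_subset_range`.
-/

namespace Summit.ValiantsHypothesis.ValiantsHypothesis.Theorems.SublinearShadowSketch

open Polynomial Finset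
open scoped BigOperators

-- `Summit.ValiantsHypothesis.ValiantsHypothesis.…` is the tree's mandated single-conjunct layout (Sub = Summit).
set_option linter.dupNamespace false

/-- In `ZMod p` with `p` prime and `p ≠ 2`, the element `2` is nonzero. [folklore] -/
theorem tsh_two_ne_zero (p : ℕ) [Fact p.Prime] (hp2 : p ≠ 2) : (2 : ZMod p) ≠ 0 :=
  Ring.two_ne_zero (by rwa [ZMod.ringChar_zmod_n])

/-- A sum `∑_{m ∈ range p} C (a m) * X ^ m` over a semiring has `natDegree < p` as soon as
`0 < p`. [folklore] -/
theorem tsh_natDegree_sum_lt {R : Type*} [Semiring R] {p : ℕ} (hp : 0 < p) (a : ℕ → R) :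
    (∑ m ∈ Finset.range p, C (a m) * X ^ m).natDegree < p := by
  have h : (∑ m ∈ Finset.range p, C (a m) * X ^ m).natDegree ≤ p - 1 :=
    natDegree_sum_le_of_forall_le _ _ fun m hm =>
      (natDegree_C_mul_X_pow_le _ _).trans (by have := mem_range.mp hm; omega)
  omega

/-- If `natDegree F < p` then `C a * (F + 1)` and `C a * (F - 1)` have `natDegree < p`.
[folklore] -/
theorem tsh_natDegree_half_lt {R : Type*} [Ring R] {p : ℕ} {F : R[X]} (hF : F.natDegree < p)
    (a : R) : (C a * (F + 1)).natDegree < p ∧ (C a * (F - 1)).natDegree < p := by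
  constructor
  · refine lt_of_le_of_lt ((natDegree_C_mul_le _ _).trans ?_) hF
    exact (natDegree_add_le _ _).trans (max_le le_rfl (by simp))
  · refine lt_of_le_of_lt ((natDegree_C_mul_le _ _).trans ?_) hF
    exact (natDegree_sub_le _ _).trans (max_le le_rfl (by simp))

/-- A polynomial of `natDegree < p` has at most `p` monomials in its support. [folklore] -/
theorem tsh_card_support_le {R : Type*} [Semiring R] {p : ℕ} {F : R[X]} (hF : F.natDegree < p) :
    F.support.card ≤ p :=
  (Finset.card_le_card (supp_subset_range hF)).trans (Finset.card_range p).le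

/-- **The trivial two-square shadow.**  For an odd prime `p`, the reduced Fekete polynomial
`F̄_p = ∑_{m < p} ((m | p) : ZMod p) X^m` is a weighted sum of `2` squares of polynomials of
`natDegree < p` and total support `≤ 2p`: `F̄_p = (2⁻¹ (F̄_p + 1))² − (2⁻¹ (F̄_p − 1))²`.
[folklore] -/
theorem stub_trivialShadow (p : ℕ) [Fact p.Prime] (hp2 : p ≠ 2) :
    ∃ (c' : Fin 2 → ZMod p) (g' : Fin 2 → Polynomial (ZMod p)),
      (∀ j, (g' j).natDegree < p) ∧ (∑ j, (g' j).support.card) ≤ 2 * p ∧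
      (∑ j, Polynomial.C (c' j) * g' j ^ 2)
        = ∑ m ∈ Finset.range p, Polynomial.C ((legendreSym p m : ℤ) : ZMod p) * Polynomial.X ^ m := by
  set F : (ZMod p)[X] := ∑ m ∈ Finset.range p, C ((legendreSym p m : ℤ) : ZMod p) * X ^ m
    with hFdef
  have hp : 0 < p := (Fact.out : p.Prime).pos
  have hF : F.natDegree < p := tsh_natDegree_sum_lt hp _
  obtain ⟨h₁, h₂⟩ := tsh_natDegree_half_lt hF (2⁻¹ : ZMod p)
  have hC : C (2⁻¹ : ZMod p) * 2 = 1 := by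
    rw [show (2 : (ZMod p)[X]) = C 2 from (map_ofNat C 2).symm, ← map_mul,
      inv_mul_cancel₀ (tsh_two_ne_zero p hp2), map_one]
  refine ⟨![1, -1], ![C (2⁻¹ : ZMod p) * (F + 1), C (2⁻¹ : ZMod p) * (F - 1)],
    Fin.forall_fin_two.mpr ⟨h₁, h₂⟩, ?_, ?_⟩
  · rw [Fin.sum_univ_two, two_mul]
    exact Nat.add_le_add (tsh_card_support_le h₁) (tsh_card_support_le h₂)
  · rw [Fin.sum_univ_two]
    simp only [Matrix.cons_val_zero, Matrix.cons_val_one, map_one, map_neg, one_mul, neg_mul]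
    linear_combination (F * (C (2⁻¹ : ZMod p) * 2 + 1)) * hC

end Summit.ValiantsHypothesis.ValiantsHypothesis.Theorems.SublinearShadowSketch
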